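import Summits.MatrixMultiplication.MatrixMultiplication.Theses.ReesMunnRealization
import Literature.Computability.AlgebraicComplexity.GroupTheoreticMatMulProofs

/-!
# `AbelianReesGivesTarget` — abelian Rees matrix hosts give constant-loss block restrictions

Route `MatrixMultiplication/ReesMunnRealization`, item `stmt-MatrixMultiplication-4377` (support, glue):
`AbelianReesFamily → BlockRestrictionFamily`.

Given the family of strict realizations `(φ, ψ, χ)` of `⟨a,b,e⟩` in the contracted algebras of the
Rees matrix semigroups `M⁰(G; n, n; P)` over finite ABELIAN groups `G` (`|G| ≥ t`, `n ≥ 1`,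
`c·(|G|n²)^{3/2} ≤ abe`), we produce the block-restriction family with `p = |G|` blocks all of
size `dᵢ = n` (so `∑ dᵢ² = |G|·n²`, `t·n² ≤ |G|·n²`, same constant `c`, and `abe ≥ 1` because
`c·(|G|n²)^{3/2} > 0`). The one non-bookkeeping point is the restriction
`⊕_{i<|G|} ⟨n,n,n⟩ ≥ ⟨a,b,e⟩`, obtained as the chain (all in the tree's coordinate-tensor language,
`TensorRestrictsTo t s` = "`t ≥ s`"):

* `matMulDirectSum ℂ d d d` (`d ≡ n` on `Fin |G|`) `≥ ⟨n,n,n⟩ ⊗ ⟨|G|⟩` — a relabelling of the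
  index set `Σ _ : Fin |G|, Fin n × Fin n ≃ (Fin n × Fin n) × Fin |G|` (`tensorRestrictsTo_precomp`);
* `⟨|G|⟩ ≥ T_{ℂ[G]}` (the multiplication table `[xy = z]` of `G`) — the `|G|` characters
  diagonalise the group algebra of an abelian group (tree: `tensorRank_addGroupAlgTensor_le`,
  `tensorRestrictsTo_unitTensor_of_tensorRank_le`; CKSU 2005 §1.1, all `dᵢ = 1`), hence
  `⟨n,n,n⟩ ⊗ ⟨|G|⟩ ≥ ⟨n,n,n⟩ ⊗ T_{ℂ[G]}` (`TensorRestrictsTo.kronecker`);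
* `⟨n,n,n⟩ ⊗ T_{ℂ[G]} ≥ B` where `B` is the structure tensor of `M_n(ℂ[G]) = ℂ₀[Brandt]` in the
  basis `(r, g, λ)` (matrix unit `E_{rλ} ⊗ g`), a relabelling;
* `B ≥ R_P`, the contracted structure tensor of `M⁰(G;n,n;P)` in the semigroup basis,
  `R_P(z; x, y) = [x ∘ y = z]`, `(r,g,λ) ∘ (ι,h,γ) = (r, g·P[λ,ι]·h, γ)` (or `0`): since
  `X ∘ Y = (X·P̂)·Y` in `M_n(ℂ[G])`, `R_P(z; x, y) = ∑_{x'} L(x, x')·B(z; x', y)` with `L` the matrix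
  of `X ↦ X·P̂` (`E_{rλ} g ↦ ∑_ι [P λ ι = p] E_{rι} (g p)`), and precomposing one slot with a linear
  map is a restriction (`tensorRestrictsTo_sum_mul_mid`);
* `R_P ≥ ⟨a,b,e⟩` — Cohn–Umans 2013 Prop. 9 in strict form: pull back along `(χ, φ, ψ)`; the
  strict-realization iff says exactly that the pulled-back tensor is `matMulTensor ℂ a b e`.

References: Cohn–Umans 2003 (Thm. 2.3, Lemma 3.1), Cohn–Kleinberg–Szegedy–Umans 2005 (§1.1),
Cohn–Umans 2013 (arXiv:1207.6528, Def. 8, Prop. 9), Bläser 2013 (§5, §7).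
-/

-- single-conjunct summit: the mandated namespace `Summit.MatrixMultiplication.MatrixMultiplication.…`
-- repeats `MatrixMultiplication` (summit = sub-problem), which `linter.dupNamespace` would flag.
set_option linter.dupNamespace false

noncomputable section

open scoped BigOperators

namespace Summit.MatrixMultiplication.MatrixMultiplication.Theorems

open Literature.Computability.AlgebraicComplexity

section Helpers

variable {K : Type*} [CommSemiring K] {ι κ μ κ' : Type*}

/-- **Precomposing one slot with a linear map is a restriction**: for any tensor `t` and any matrix
`L`, `t ≥ (z, x, y) ↦ ∑_{x'} L x x' · t z x' y` (take `A = C = 1`, `B = L` in the definition of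
`TensorRestrictsTo`; Bürgisser–Clausen–Shokrollahi 1997, Def. (14.27)). [folklore] -/
theorem tensorRestrictsTo_sum_mul_mid [Fintype ι] [Fintype κ] [Fintype μ] [DecidableEq ι]
    [DecidableEq μ] (t : ι → κ → μ → K) (L : κ' → κ → K) :
    TensorRestrictsTo t (fun a b c => ∑ b', L b b' * t a b' c) := by
  refine ⟨fun a' a => if a = a' then 1 else 0, L, fun c' c => if c = c' then 1 else 0,
    fun a' b' c' => ?_⟩
  rw [Finset.sum_eq_single a' (fun a _ ha => by simp [ha]) (by simp)]
  refine Finset.sum_congr rfl fun b _ => ?_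
  rw [Finset.sum_eq_single c' (fun c _ hc => by simp [hc]) (by simp)]
  simp

end Helpers

/-- **The characters diagonalise `ℂ[G]` for abelian `G`**, restriction form: the multiplication
table `(z, x, y) ↦ [x·y = z]` of a finite abelian group `G` (the structure tensor of `ℂ[G]` in the
basis `G`) is a restriction of the unit tensor `⟨|G|⟩` (CKSU 2005, §1.1: `ℂ[G] ≅ ⊕ᵢ ℂ^{dᵢ×dᵢ}` with
all `dᵢ = 1`). From the tree's `tensorRank_addGroupAlgTensor_le` (applied to `Additive G`) and
`tensorRestrictsTo_unitTensor_of_tensorRank_le`. [folklore] -/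
theorem unitTensor_restrictsTo_mulTable (G : Type*) [CommGroup G] [Fintype G] [DecidableEq G] :
    TensorRestrictsTo (unitTensor ℂ (Fintype.card G))
      (fun z x y : G => if x * y = z then (1 : ℂ) else 0) := by
  have hr : tensorRank (fun z x y : Additive G => if x + y = z then (1 : ℂ) else 0) ≤
      Fintype.card G :=
    (tensorRank_addGroupAlgTensor_le (Additive G)).trans_eq (Fintype.card_additive G)
  exact (tensorRestrictsTo_unitTensor_of_tensorRank_le _ hr).trans
    (tensorRestrictsTo_precomp _ Additive.ofMul Additive.ofMul Additive.ofMul)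

/-- **Blocks of an abelian Rees host** (`ReesHostBlocks`, abelian case, any sandwich matrix `P`,
invertibility not needed): the contracted structure tensor of the Rees matrix semigroup
`M⁰(G; n, n; P)` over a finite abelian group `G`, in its semigroup basis `(r, g, λ)` with product
`(r,g,λ)(ι,h,γ) = (r, g·P[λ,ι]·h, γ)` (or `0` when `P[λ,ι] = 0`), is a restriction of
`⊕_{i<|G|} ⟨n, n, n⟩ = matMulDirectSum ℂ d d d`, `d ≡ n` on `Fin |G|`. Chain: relabel
`⊕ ⟨n,n,n⟩ = ⟨n,n,n⟩ ⊗ ⟨|G|⟩`; `⟨|G|⟩ ≥ [xy = z]` (characters); relabel `⟨n,n,n⟩ ⊗ [xy = z]` as the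
Brandt tensor `B` on `Fin n × G × Fin n`; and `X ∘ Y = (X·P̂)·Y`, i.e. the Rees tensor is `B`
precomposed in the `X`-slot with the matrix of `X ↦ X·P̂` (Cohn–Umans 2003 §2 / CKSU 2005 §1.1 for
the group algebra; the sandwich step is the Munn representation `ℂ₀[M⁰(G;n,n;P)] → M_n(ℂ[G])`).
[folklore] -/
theorem matMulDirectSum_restrictsTo_reesTensor (G : Type*) [CommGroup G] [Fintype G]
    [DecidableEq G] (n : ℕ) (P : Fin n → Fin n → Option G) :
    TensorRestrictsTo
      (matMulDirectSum ℂ (fun _ : Fin (Fintype.card G) => n) (fun _ => n) (fun _ => n))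
      (fun (z x y : Fin n × G × Fin n) =>
        if (P x.2.2 y.1).map (fun p => (x.1, x.2.1 * p * y.2.1, y.2.2)) = some z
        then (1 : ℂ) else 0) := by
  -- (a) `⊕_{i<|G|} ⟨n,n,n⟩ ≥ ⟨n,n,n⟩ ⊗ ⟨|G|⟩` (relabelling)
  have ha : TensorRestrictsTo
      (matMulDirectSum ℂ (fun _ : Fin (Fintype.card G) => n) (fun _ => n) (fun _ => n))
      (kroneckerTensor (matMulTensor ℂ n n n) (unitTensor ℂ (Fintype.card G))) := by
    have heq : kroneckerTensor (matMulTensor ℂ n n n) (unitTensor ℂ (Fintype.card G)) =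
        fun a b c => matMulDirectSum ℂ (fun _ : Fin (Fintype.card G) => n) (fun _ => n) (fun _ => n)
          ⟨a.2, a.1⟩ ⟨b.2, b.1⟩ ⟨c.2, c.1⟩ := by
      funext a b c
      simp only [kroneckerTensor_apply, unitTensor_apply, matMulTensor, matMulDirectSum]
      rw [ite_zero_mul_ite_zero, one_mul]
      refine if_congr ?_ rfl rfl
      simp only [Fin.ext_iff]
      tauto
    rw [heq]
    exact tensorRestrictsTo_precomp _
      (fun a : (Fin n × Fin n) × Fin (Fintype.card G) =>
        (⟨a.2, a.1⟩ : Σ _ : Fin (Fintype.card G), Fin n × Fin n))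
      (fun b : (Fin n × Fin n) × Fin (Fintype.card G) =>
        (⟨b.2, b.1⟩ : Σ _ : Fin (Fintype.card G), Fin n × Fin n))
      (fun c : (Fin n × Fin n) × Fin (Fintype.card G) =>
        (⟨c.2, c.1⟩ : Σ _ : Fin (Fintype.card G), Fin n × Fin n))
  -- (b)+(c) `⟨n,n,n⟩ ⊗ ⟨|G|⟩ ≥ ⟨n,n,n⟩ ⊗ [xy = z]` (characters of the abelian group `G`)
  have hc : TensorRestrictsTo
      (kroneckerTensor (matMulTensor ℂ n n n) (unitTensor ℂ (Fintype.card G)))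
      (kroneckerTensor (matMulTensor ℂ n n n)
        (fun z x y : G => if x * y = z then (1 : ℂ) else 0)) :=
    (TensorRestrictsTo.refl _).kronecker (unitTensor_restrictsTo_mulTable G)
  -- (d) the Brandt tensor `B` on `Fin n × G × Fin n` is a relabelling of `⟨n,n,n⟩ ⊗ [xy = z]`
  set B : (Fin n × G × Fin n) → (Fin n × G × Fin n) → (Fin n × G × Fin n) → ℂ := fun z x y =>
    kroneckerTensor (matMulTensor ℂ n n n) (fun z x y : G => if x * y = z then (1 : ℂ) else 0)
      ((z.1, z.2.2), z.2.1) ((x.1, x.2.2), x.2.1) ((y.1, y.2.2), y.2.1) with hB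
  have hd : TensorRestrictsTo
      (kroneckerTensor (matMulTensor ℂ n n n)
        (fun z x y : G => if x * y = z then (1 : ℂ) else 0)) B :=
    tensorRestrictsTo_precomp _
      (fun z : Fin n × G × Fin n => ((z.1, z.2.2), z.2.1))
      (fun x : Fin n × G × Fin n => ((x.1, x.2.2), x.2.1))
      (fun y : Fin n × G × Fin n => ((y.1, y.2.2), y.2.1))
  -- (e) the Rees tensor is `B` precomposed with the matrix `L` of `X ↦ X·P̂` in the `X`-slot
  set L : (Fin n × G × Fin n) → (Fin n × G × Fin n) → ℂ := fun x x' =>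
    if x'.1 = x.1 ∧ (P x.2.2 x'.2.2).map (fun p => x.2.1 * p) = some x'.2.1 then 1 else 0 with hL
  have he : (fun (z x y : Fin n × G × Fin n) =>
        if (P x.2.2 y.1).map (fun p => (x.1, x.2.1 * p * y.2.1, y.2.2)) = some z
        then (1 : ℂ) else 0) = fun z x y => ∑ x', L x x' * B z x' y := by
    funext z x y
    have hS : ∀ x' : Fin n × G × Fin n, L x x' * B z x' y =
        if (x'.1 = x.1 ∧ (P x.2.2 x'.2.2).map (fun p => x.2.1 * p) = some x'.2.1) ∧
          ((z.1 = x'.1 ∧ x'.2.2 = y.1 ∧ z.2.2 = y.2.2) ∧ x'.2.1 * y.2.1 = z.2.1)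
        then 1 else 0 := by
      intro x'
      simp only [hL, hB, kroneckerTensor_apply, matMulTensor]
      rw [ite_zero_mul_ite_zero, one_mul, ite_zero_mul_ite_zero, one_mul]
    simp only [hS]
    cases hP : P x.2.2 y.1 with
    | none =>
      rw [if_neg (by simp)]
      symm
      refine Finset.sum_eq_zero fun x' _ => if_neg ?_
      rintro ⟨⟨-, hx'⟩, ⟨-, hcol, -⟩, -⟩
      rw [hcol, hP] at hx'
      simp at hx'
    | some p =>
      rw [Finset.sum_eq_single (x.1, x.2.1 * p, y.1)]
      · refine if_congr ?_ rfl rfl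
        constructor
        · intro h
          simp only [Option.map_some, Option.some.injEq] at h
          subst h
          refine ⟨⟨rfl, ?_⟩, ⟨rfl, rfl, rfl⟩, rfl⟩
          dsimp only
          rw [hP]
          rfl
        · rintro ⟨-, ⟨h1, -, h3⟩, h2⟩
          obtain ⟨z1, z2, z3⟩ := z
          dsimp only at h1 h2 h3
          subst h1 h3 h2
          rfl
      · intro x' _ hne
        refine if_neg ?_
        rintro ⟨⟨h1, hx'⟩, ⟨-, hcol, -⟩, -⟩
        apply hne
        rw [hcol, hP] at hx'
        simp only [Option.map_some, Option.some.injEq] at hx'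
        obtain ⟨a1, a2, a3⟩ := x'
        dsimp only at h1 hcol hx' ⊢
        rw [h1, hcol, ← hx']
      · intro h
        exact absurd (Finset.mem_univ _) h
  have hfin : TensorRestrictsTo B (fun (z x y : Fin n × G × Fin n) =>
        if (P x.2.2 y.1).map (fun p => (x.1, x.2.1 * p * y.2.1, y.2.2)) = some z
        then (1 : ℂ) else 0) := by
    rw [he]
    exact tensorRestrictsTo_sum_mul_mid B L
  exact ha.trans (hc.trans (hd.trans hfin))

/-- **`AbelianReesGivesTarget`** (settles `stmt-MatrixMultiplication-4377`, exact route signature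
`Summit.MatrixMultiplication.MatrixMultiplication.Theses.ReesMunnRealization.AbelianReesGivesTarget`):
`AbelianReesFamily → BlockRestrictionFamily`. For the host of parameter `t` take `p = |G|` blocks
`dᵢ = n`: then `∑ dᵢ² = |G|·n²`, so the packing bound is the given one with the same `c`, every block
is small (`t·n² ≤ |G|·n²` from `t ≤ |G|`), `abe ≥ 1` since `c·(|G|n²)^{3/2} > 0`, and
`⊕_{i<|G|} ⟨n,n,n⟩ ≥ R_P ≥ ⟨a,b,e⟩` by `matMulDirectSum_restrictsTo_reesTensor` (abelian
`ReesHostBlocks`) and the strict-realization pull-back along `(χ, φ, ψ)` (Cohn–Umans 2013, Prop. 9,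
`RealizationRestricts`), composed with `TensorRestrictsTo.trans`. [folklore] -/
theorem AbelianReesGivesTarget_proof :
    Summit.MatrixMultiplication.MatrixMultiplication.Theses.ReesMunnRealization.AbelianReesGivesTarget := by
  unfold Summit.MatrixMultiplication.MatrixMultiplication.Theses.ReesMunnRealization.AbelianReesGivesTarget
    Summit.MatrixMultiplication.MatrixMultiplication.Theses.ReesMunnRealization.AbelianReesFamily
    Summit.MatrixMultiplication.MatrixMultiplication.Theses.ReesMunnRealization.BlockRestrictionFamily
  rintro ⟨c, hc, hfam⟩
  refine ⟨c, hc, fun t => ?_⟩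
  obtain ⟨G, _instG, _instF, n, a, b, e, P, φ, ψ, χ, hn, ht, hreal, hpack⟩ := hfam t
  classical
  -- `∑_{i<|G|} n² = |G|·n²`
  have hsum : ∑ _i : Fin (Fintype.card G), ((n : ℕ) : ℝ) ^ 2 =
      (Fintype.card G : ℝ) * (n : ℝ) ^ 2 := by
    rw [Finset.sum_const, Finset.card_univ, Fintype.card_fin, nsmul_eq_mul]
  refine ⟨Fintype.card G, fun _ => n, a, b, e, Fintype.card_pos, fun _ => hn, ?_, ?_, ?_, ?_⟩
  · -- `abe ≥ 1` from `0 < c·(|G|n²)^{3/2} ≤ abe`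
    have hGpos : (0 : ℝ) < (Fintype.card G : ℝ) := Nat.cast_pos.mpr Fintype.card_pos
    have hnpos : (0 : ℝ) < (n : ℝ) := Nat.cast_pos.mpr hn
    have hpos : (0 : ℝ) < c * ((Fintype.card G : ℝ) * (n : ℝ) ^ 2) ^ ((3 : ℝ) / 2) :=
      mul_pos hc (Real.rpow_pos_of_pos (mul_pos hGpos (pow_pos hnpos 2)) _)
    exact Nat.cast_pos.mp (hpos.trans_le hpack)
  · -- the restriction `⊕_{i<|G|} ⟨n,n,n⟩ ≥ R_P ≥ ⟨a,b,e⟩`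
    refine (matMulDirectSum_restrictsTo_reesTensor G n P).trans ?_
    have key : matMulTensor ℂ a b e = fun z x y =>
        (fun (z x y : Fin n × G × Fin n) =>
          if (P x.2.2 y.1).map (fun p => (x.1, x.2.1 * p * y.2.1, y.2.2)) = some z
          then (1 : ℂ) else 0) (χ z) (φ x) (ψ y) := by
      funext z x y
      simp only [matMulTensor]
      exact if_congr (hreal x y z).symm rfl rfl
    rw [key]
    exact tensorRestrictsTo_precomp _ χ φ ψ
  · -- packing: same constant
    simp only [hsum]
    exact hpack
  · -- every block is small: `t·n² ≤ |G|·n²`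
    intro i
    simp only [hsum]
    exact mul_le_mul_of_nonneg_right (by exact_mod_cast ht) (sq_nonneg _)

end Summit.MatrixMultiplication.MatrixMultiplication.Theorems

end
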